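import Mathlib

/-!
# Increment convexity of the alternating block energy, III: triangular lattice sums

Helper for stub `stub_convexity` of line `Sketch` of crux `PeriodicGivenLayered`
(stmt-AtomisticToContinuum-11779). Certified bounds for lattice sums over `ℤ²` indexed by the sites
`(i, j)` of a triangular layer (normalised in-plane form
`P_δ(i,j) = (i + j/2 + δ/2)² + (3/4)(j + δ/3)²`, `δ ∈ {0, 1}` the lateral offset): square shells
`[-M,M]² ∖ [-(M-1),M-1]²` have `8M` sites, on which `P_δ ≥ (3/4)(M - 1/3)²`; a telescoping estimate
then bounds `∑'_{ℤ²} F ≤ ∑_{[-N,N]²} F + (explicit tail)` for every nonnegative `F` dominated on the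
shells by `C ((3/4)(r - 1/3)² + T)^{-(n+1)}`, and gives summability. Also: the reindexing of a box
sum by `range`, and the summability of the Lennard-Jones layer terms. [folklore]
-/

noncomputable section

namespace Summit.AtomisticToContinuum.Crystallization.Theorems.LayeredHull

open Finset

/-! ## Boxes and shells in `ℤ²` -/

/-- Membership in the box `[-M, M]²`. [folklore] -/
theorem cvx_mem_box {M : ℕ} {p : ℤ × ℤ} :
    p ∈ Icc (-(M : ℤ)) M ×ˢ Icc (-(M : ℤ)) M ↔ |p.1| ≤ M ∧ |p.2| ≤ M := by
  obtain ⟨i, j⟩ := p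
  simp only [Finset.mem_product, Finset.mem_Icc, abs_le]

/-- The boxes increase. [folklore] -/
theorem cvx_box_mono {M M' : ℕ} (h : M ≤ M') :
    Icc (-(M : ℤ)) M ×ˢ Icc (-(M : ℤ)) M ⊆ Icc (-(M' : ℤ)) M' ×ˢ Icc (-(M' : ℤ)) M' := by
  intro p hp
  rw [cvx_mem_box] at hp ⊢
  have : (M : ℤ) ≤ M' := by exact_mod_cast h
  exact ⟨hp.1.trans this, hp.2.trans this⟩

/-- `#[-M, M]² = (2M+1)²`. [folklore] -/
theorem cvx_card_box (M : ℕ) : (Icc (-(M : ℤ)) M ×ˢ Icc (-(M : ℤ)) M).card = (2 * M + 1) ^ 2 := by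
  simp only [Finset.card_product, Int.card_Icc]
  have : ((M : ℤ) + 1 - -(M : ℤ)).toNat = 2 * M + 1 := by omega
  rw [this]; ring

/-- A shell `[-M, M]² ∖ [-(M-1), M-1]²` has `8M` sites. [folklore] -/
theorem cvx_card_shell {M : ℕ} (hM : 1 ≤ M) :
    (((Icc (-(M : ℤ)) M ×ˢ Icc (-(M : ℤ)) M) \
      (Icc (-((M - 1 : ℕ) : ℤ)) (M - 1 : ℕ) ×ˢ Icc (-((M - 1 : ℕ) : ℤ)) (M - 1 : ℕ))).card : ℝ) =
      8 * (M : ℝ) := by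
  rw [Finset.card_sdiff_of_subset (cvx_box_mono (Nat.sub_le M 1)), cvx_card_box, cvx_card_box]
  obtain ⟨m, rfl⟩ : ∃ m, M = m + 1 := ⟨M - 1, by omega⟩
  simp only [Nat.add_sub_cancel]
  have h : (2 * m + 1) ^ 2 ≤ (2 * (m + 1) + 1) ^ 2 := Nat.pow_le_pow_left (by omega) 2
  have : (2 * (m + 1) + 1) ^ 2 - (2 * m + 1) ^ 2 = 8 * (m + 1) := by
    zify [h]; ring
  rw [this]; push_cast; ring

/-- On a shell the sup norm is the shell index. [folklore] -/
theorem cvx_shell_max {M : ℕ} {p : ℤ × ℤ}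
    (hp : p ∈ (Icc (-(M : ℤ)) M ×ˢ Icc (-(M : ℤ)) M) \
      (Icc (-((M - 1 : ℕ) : ℤ)) (M - 1 : ℕ) ×ˢ Icc (-((M - 1 : ℕ) : ℤ)) (M - 1 : ℕ)))
    (hM : 1 ≤ M) : max |p.1| |p.2| = M := by
  rw [Finset.mem_sdiff, cvx_mem_box, cvx_mem_box] at hp
  have h1 : ((M - 1 : ℕ) : ℤ) = M - 1 := by omega
  rw [h1] at hp
  omega

/-! ## The telescoping estimate -/

/-- `n (B - A) B^{-(n+1)} ≤ A^{-n} - B^{-n}` for `0 < A ≤ B`. [folklore] -/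
theorem cvx_inv_pow_sub_inv_pow {A B : ℝ} (hA : 0 < A) (hAB : A ≤ B) (n : ℕ) :
    (n : ℝ) * (B - A) * (B⁻¹) ^ (n + 1) ≤ (A⁻¹) ^ n - (B⁻¹) ^ n := by
  have hB : 0 < B := hA.trans_le hAB
  set u := A⁻¹ with hu
  set v := B⁻¹ with hv
  have hv0 : 0 < v := inv_pos.2 hB
  have huv : v ≤ u := by rw [hu, hv]; exact inv_anti₀ hA hAB
  have hkey : u - v = (B - A) * u * v := by
    rw [hu, hv]; field_simp
  induction n with
  | zero => simp
  | succ n ih =>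
    have hvn : 0 ≤ v ^ n := pow_nonneg hv0.le n
    have hvn1 : 0 < v ^ (n + 1) := pow_pos hv0 _
    have hdiff : 0 ≤ u ^ n - v ^ n := sub_nonneg.2 (pow_le_pow_left₀ hv0.le huv n)
    have e1 : u ^ (n + 1) - v ^ (n + 1) = u * (u ^ n - v ^ n) + v ^ n * (u - v) := by ring
    have hBA : 0 ≤ B - A := sub_nonneg.2 hAB
    calc ((n + 1 : ℕ) : ℝ) * (B - A) * v ^ (n + 1 + 1)
        = v * ((n : ℝ) * (B - A) * v ^ (n + 1)) + v ^ n * ((B - A) * v * v) := by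
          push_cast; ring
      _ ≤ v * (u ^ n - v ^ n) + v ^ n * ((B - A) * u * v) := by
          apply add_le_add
          · exact mul_le_mul_of_nonneg_left ih hv0.le
          · apply mul_le_mul_of_nonneg_left _ hvn
            apply mul_le_mul_of_nonneg_right _ hv0.le
            exact mul_le_mul_of_nonneg_left huv hBA
      _ ≤ u * (u ^ n - v ^ n) + v ^ n * (u - v) := by
          rw [hkey]
          exact add_le_add (mul_le_mul_of_nonneg_right huv hdiff) le_rfl
      _ = u ^ (n + 1) - v ^ (n + 1) := e1.symm

/-- **The shell step of the telescoping bound**: for `M ≥ N ≥ 1`, `n ≥ 1`, `T > 0`,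
`8(M+1) B^{-(n+1)} ≤ (32(N+1)/(n(6N+1))) (A^{-n} - B^{-n})` with `A = (3/4)(M - 1/3)² + T`,
`B = (3/4)(M + 2/3)² + T`. [folklore] -/
theorem cvx_shell_telescope {N n M : ℕ} (hN : 1 ≤ N) (hn : 1 ≤ n) (hM : N ≤ M) {T : ℝ}
    (hT : 0 < T) :
    8 * ((M : ℝ) + 1) * ((3 / 4 * ((M : ℝ) + 2 / 3) ^ 2 + T)⁻¹) ^ (n + 1) ≤
      32 * ((N : ℝ) + 1) / (n * (6 * N + 1)) *
        (((3 / 4 * ((M : ℝ) - 1 / 3) ^ 2 + T)⁻¹) ^ n - ((3 / 4 * ((M : ℝ) + 2 / 3) ^ 2 + T)⁻¹) ^ n) := by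
  set A := 3 / 4 * ((M : ℝ) - 1 / 3) ^ 2 + T with hA
  set B := 3 / 4 * ((M : ℝ) + 2 / 3) ^ 2 + T with hB
  have hA0 : 0 < A := by rw [hA]; positivity
  have hBA : B - A = 3 / 2 * M + 1 / 4 := by rw [hA, hB]; ring
  have hAB : A ≤ B := by linarith [(Nat.cast_nonneg M : (0 : ℝ) ≤ M)]
  have hB0 : 0 < B := hA0.trans_le hAB
  have htel := cvx_inv_pow_sub_inv_pow hA0 hAB n
  have hNM : (N : ℝ) ≤ M := by exact_mod_cast hM
  have hN1 : (1 : ℝ) ≤ N := by exact_mod_cast hN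
  have hn1 : (1 : ℝ) ≤ n := by exact_mod_cast hn
  have hcoef : 8 * ((M : ℝ) + 1) ≤ 32 * ((N : ℝ) + 1) / (n * (6 * N + 1)) * (n * (B - A)) := by
    rw [hBA, div_mul_eq_mul_div, le_div_iff₀ (by positivity)]
    nlinarith [mul_nonneg (sub_nonneg.2 hNM) (by positivity : (0 : ℝ) ≤ n)]
  have hpos : 0 ≤ (B⁻¹) ^ (n + 1) := by positivity
  calc 8 * ((M : ℝ) + 1) * (B⁻¹) ^ (n + 1)
      ≤ 32 * ((N : ℝ) + 1) / (n * (6 * N + 1)) * (n * (B - A)) * (B⁻¹) ^ (n + 1) :=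
        mul_le_mul_of_nonneg_right hcoef hpos
    _ = 32 * ((N : ℝ) + 1) / (n * (6 * N + 1)) * ((n : ℝ) * (B - A) * (B⁻¹) ^ (n + 1)) := by ring
    _ ≤ 32 * ((N : ℝ) + 1) / (n * (6 * N + 1)) * ((A⁻¹) ^ n - (B⁻¹) ^ n) :=
        mul_le_mul_of_nonneg_left htel (by positivity)

/-- **Box sums are bounded by the `N`-box plus the telescoped tail.** [folklore] -/
theorem cvx_box_sum_le {F : ℤ × ℤ → ℝ} {N n : ℕ} (hN : 1 ≤ N) (hn : 1 ≤ n)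
    {C T : ℝ} (hC : 0 ≤ C) (hT : 0 < T)
    (hF : ∀ p : ℤ × ℤ, (N : ℤ) + 1 ≤ max |p.1| |p.2| →
      F p ≤ C * ((3 / 4 * (((max |p.1| |p.2| : ℤ) : ℝ) - 1 / 3) ^ 2 + T)⁻¹) ^ (n + 1))
    (M : ℕ) (hM : N ≤ M) :
    ∑ p ∈ Icc (-(M : ℤ)) M ×ˢ Icc (-(M : ℤ)) M, F p +
        32 * ((N : ℝ) + 1) / (n * (6 * N + 1)) * C * ((3 / 4 * ((M : ℝ) - 1 / 3) ^ 2 + T)⁻¹) ^ n ≤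
      ∑ p ∈ Icc (-(N : ℤ)) N ×ˢ Icc (-(N : ℤ)) N, F p +
        32 * ((N : ℝ) + 1) / (n * (6 * N + 1)) * C * ((3 / 4 * ((N : ℝ) - 1 / 3) ^ 2 + T)⁻¹) ^ n := by
  induction M, hM using Nat.le_induction with
  | base => exact le_refl _
  | succ M hNM ih =>
    -- split off the shell `M + 1`
    have hsub := cvx_box_mono (M := M) (M' := M + 1) (Nat.le_succ M)
    rw [← Finset.sum_sdiff hsub]
    have hshell : ∑ p ∈ (Icc (-((M + 1 : ℕ) : ℤ)) (M + 1 : ℕ) ×ˢ Icc (-((M + 1 : ℕ) : ℤ)) (M + 1 : ℕ)) \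
        (Icc (-(M : ℤ)) M ×ˢ Icc (-(M : ℤ)) M), F p ≤
        8 * ((M : ℝ) + 1) * (C * ((3 / 4 * ((M : ℝ) + 2 / 3) ^ 2 + T)⁻¹) ^ (n + 1)) := by
      have hb : ∀ p ∈ (Icc (-((M + 1 : ℕ) : ℤ)) (M + 1 : ℕ) ×ˢ Icc (-((M + 1 : ℕ) : ℤ)) (M + 1 : ℕ)) \
          (Icc (-(M : ℤ)) M ×ˢ Icc (-(M : ℤ)) M),
          F p ≤ C * ((3 / 4 * ((M : ℝ) + 2 / 3) ^ 2 + T)⁻¹) ^ (n + 1) := by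
        intro p hp
        have hmax : max |p.1| |p.2| = (M + 1 : ℕ) := by
          have hp' : p ∈ (Icc (-((M + 1 : ℕ) : ℤ)) (M + 1 : ℕ) ×ˢ
              Icc (-((M + 1 : ℕ) : ℤ)) (M + 1 : ℕ)) \
              (Icc (-((M + 1 - 1 : ℕ) : ℤ)) (M + 1 - 1 : ℕ) ×ˢ
                Icc (-((M + 1 - 1 : ℕ) : ℤ)) (M + 1 - 1 : ℕ)) := by
            simpa only [Nat.add_sub_cancel] using hp
          exact cvx_shell_max hp' (by omega)
        have h1 := hF p (by rw [hmax]; push_cast; exact_mod_cast Nat.succ_le_succ hNM)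
        rw [hmax] at h1
        have e : (((M + 1 : ℕ) : ℤ) : ℝ) - 1 / 3 = (M : ℝ) + 2 / 3 := by push_cast; ring
        rwa [e] at h1
      calc ∑ p ∈ _, F p ≤ ∑ _p ∈ (Icc (-((M + 1 : ℕ) : ℤ)) (M + 1 : ℕ) ×ˢ
            Icc (-((M + 1 : ℕ) : ℤ)) (M + 1 : ℕ)) \ (Icc (-(M : ℤ)) M ×ˢ Icc (-(M : ℤ)) M),
            C * ((3 / 4 * ((M : ℝ) + 2 / 3) ^ 2 + T)⁻¹) ^ (n + 1) := Finset.sum_le_sum hb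
        _ = _ := by
          rw [Finset.sum_const, nsmul_eq_mul]
          have hc := cvx_card_shell (M := M + 1) (by omega)
          simp only [Nat.add_sub_cancel] at hc
          rw [hc]; push_cast; ring
    have htel := cvx_shell_telescope hN hn hNM hT (M := M)
    have e2 : ((M + 1 : ℕ) : ℝ) - 1 / 3 = (M : ℝ) + 2 / 3 := by push_cast; ring
    rw [e2]
    have hC' : 0 ≤ 32 * ((N : ℝ) + 1) / (n * (6 * N + 1)) := by positivity
    have key : 8 * ((M : ℝ) + 1) * (C * ((3 / 4 * ((M : ℝ) + 2 / 3) ^ 2 + T)⁻¹) ^ (n + 1)) ≤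
        32 * ((N : ℝ) + 1) / (n * (6 * N + 1)) * C *
          (((3 / 4 * ((M : ℝ) - 1 / 3) ^ 2 + T)⁻¹) ^ n -
            ((3 / 4 * ((M : ℝ) + 2 / 3) ^ 2 + T)⁻¹) ^ n) := by
      have := mul_le_mul_of_nonneg_left htel hC
      calc 8 * ((M : ℝ) + 1) * (C * ((3 / 4 * ((M : ℝ) + 2 / 3) ^ 2 + T)⁻¹) ^ (n + 1))
          = C * (8 * ((M : ℝ) + 1) * ((3 / 4 * ((M : ℝ) + 2 / 3) ^ 2 + T)⁻¹) ^ (n + 1)) := by ring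
        _ ≤ C * (32 * ((N : ℝ) + 1) / (n * (6 * N + 1)) *
            (((3 / 4 * ((M : ℝ) - 1 / 3) ^ 2 + T)⁻¹) ^ n -
              ((3 / 4 * ((M : ℝ) + 2 / 3) ^ 2 + T)⁻¹) ^ n)) := this
        _ = _ := by ring
    linarith [ih, hshell, key]

/-- **Lattice sums over `ℤ²`, bounded by a box plus an explicit tail.** If `F ≥ 0` and, on every
square shell of sup norm `r ≥ N + 1`, `F ≤ C ((3/4)(r - 1/3)² + T)^{-(n+1)}`, then `F` is summable and
`∑' F ≤ ∑_{[-N,N]²} F + (32(N+1)/(n(6N+1))) C ((3/4)(N - 1/3)² + T)^{-n}`. [folklore] -/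
theorem cvx_lattice_tsum_le {F : ℤ × ℤ → ℝ} (hF0 : ∀ p, 0 ≤ F p) {N n : ℕ} (hN : 1 ≤ N)
    (hn : 1 ≤ n) {C T : ℝ} (hC : 0 ≤ C) (hT : 0 < T)
    (hF : ∀ p : ℤ × ℤ, (N : ℤ) + 1 ≤ max |p.1| |p.2| →
      F p ≤ C * ((3 / 4 * (((max |p.1| |p.2| : ℤ) : ℝ) - 1 / 3) ^ 2 + T)⁻¹) ^ (n + 1)) :
    Summable F ∧ ∑' p, F p ≤ ∑ p ∈ Icc (-(N : ℤ)) N ×ˢ Icc (-(N : ℤ)) N, F p +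
      32 * ((N : ℝ) + 1) / (n * (6 * N + 1)) * C * ((3 / 4 * ((N : ℝ) - 1 / 3) ^ 2 + T)⁻¹) ^ n := by
  set bound := ∑ p ∈ Icc (-(N : ℤ)) N ×ˢ Icc (-(N : ℤ)) N, F p +
      32 * ((N : ℝ) + 1) / (n * (6 * N + 1)) * C * ((3 / 4 * ((N : ℝ) - 1 / 3) ^ 2 + T)⁻¹) ^ n
    with hbound
  have hfin : ∀ u : Finset (ℤ × ℤ), ∑ p ∈ u, F p ≤ bound := by
    intro u
    -- `u` lies in some box `[-M, M]²` with `M ≥ N`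
    set M : ℕ := N + ∑ p ∈ u, ((|p.1| + |p.2|).toNat) with hMdef
    have hsub : u ⊆ Icc (-(M : ℤ)) M ×ˢ Icc (-(M : ℤ)) M := by
      intro p hp
      rw [cvx_mem_box]
      have h1 : (|p.1| + |p.2|).toNat ≤ ∑ q ∈ u, (|q.1| + |q.2|).toNat :=
        Finset.single_le_sum (f := fun q : ℤ × ℤ => (|q.1| + |q.2|).toNat) (fun _ _ => Nat.zero_le _) hp
      have h2 : (|p.1| + |p.2|) ≤ ((|p.1| + |p.2|).toNat : ℤ) := Int.self_le_toNat _
      have h3 : ((∑ q ∈ u, (|q.1| + |q.2|).toNat : ℕ) : ℤ) ≤ M := by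
        rw [hMdef]; push_cast; linarith
      have h4 : ((|p.1| + |p.2|).toNat : ℤ) ≤ ((∑ q ∈ u, (|q.1| + |q.2|).toNat : ℕ) : ℤ) := by
        exact_mod_cast h1
      constructor
      · linarith [abs_nonneg p.2]
      · linarith [abs_nonneg p.1]
    have hMN : N ≤ M := Nat.le_add_right _ _
    have hbox := cvx_box_sum_le hN hn hC hT hF M hMN
    have hnonneg : 0 ≤ 32 * ((N : ℝ) + 1) / (n * (6 * N + 1)) * C *
        ((3 / 4 * ((M : ℝ) - 1 / 3) ^ 2 + T)⁻¹) ^ n := by positivity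
    calc ∑ p ∈ u, F p ≤ ∑ p ∈ Icc (-(M : ℤ)) M ×ˢ Icc (-(M : ℤ)) M, F p :=
          Finset.sum_le_sum_of_subset_of_nonneg hsub fun p _ _ => hF0 p
      _ ≤ bound := by rw [hbound]; linarith
  exact ⟨summable_of_sum_le hF0 hfin, Real.tsum_le_of_sum_le hF0 hfin⟩

/-! ## Reindexing a box sum -/

/-- `[-K, K] ⊆ ℤ` as the image of `range (2K+1)` (adapted from the tree's
`ExcessDecayLiouvilleCoarseGrains.hcpSum_Icc_eq_image_range`). [folklore] -/
theorem cvx_Icc_eq_image_range (K : ℕ) :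
    Finset.Icc (-(K : ℤ)) K = (Finset.range (2 * K + 1)).image fun kk : ℕ => (kk : ℤ) - K := by
  ext x
  simp only [Finset.mem_Icc, Finset.mem_image, Finset.mem_range]
  constructor
  · intro h
    exact ⟨(x + K).toNat, by omega, by omega⟩
  · rintro ⟨kk, hkk, rfl⟩
    omega

/-- Reindexing a sum over `[-K, K]` by `range (2K+1)`. [folklore] -/
theorem cvx_sum_Icc_eq_sum_range (K : ℕ) (g : ℤ → ℝ) :
    ∑ k ∈ Finset.Icc (-(K : ℤ)) K, g k = ∑ kk ∈ Finset.range (2 * K + 1), g ((kk : ℤ) - K) := by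
  rw [cvx_Icc_eq_image_range, Finset.sum_image]
  intro a _ b _ h
  have : (a : ℤ) = b := by linarith
  exact_mod_cast this

/-- **Reindexing the box sum** by shifted natural indices. [folklore] -/
theorem cvx_sum_box_eq_sum_range (K : ℕ) (G : ℤ × ℤ → ℝ) :
    ∑ p ∈ Icc (-(K : ℤ)) K ×ˢ Icc (-(K : ℤ)) K, G p =
      ∑ ii ∈ Finset.range (2 * K + 1), ∑ jj ∈ Finset.range (2 * K + 1),
        G ((ii : ℤ) - K, (jj : ℤ) - K) := by
  rw [Finset.sum_product, cvx_sum_Icc_eq_sum_range]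
  refine Finset.sum_congr rfl fun ii _ => ?_
  rw [cvx_sum_Icc_eq_sum_range]

/-! ## Geometry of the triangular layer -/

/-- **Shell lower bound for the in-plane form**: for `δ ∈ {0, 1}` and `max(|i|,|j|) = r ≥ 1`,
`P_δ(i,j) = (i + j/2 + δ/2)² + (3/4)(j + δ/3)² ≥ (3/4)(r - 1/3)²`. [folklore] -/
theorem cvx_P_ge_shell (δ : ℤ) (hδ : δ = 0 ∨ δ = 1) (p : ℤ × ℤ) (hr : 1 ≤ max |p.1| |p.2|) :
    3 / 4 * (((max |p.1| |p.2| : ℤ) : ℝ) - 1 / 3) ^ 2 ≤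
      ((p.1 : ℝ) + p.2 / 2 + δ / 2) ^ 2 + 3 / 4 * ((p.2 : ℝ) + δ / 3) ^ 2 := by
  obtain ⟨i, j⟩ := p
  simp only at hr ⊢
  have hd0 : (0 : ℝ) ≤ δ := by rcases hδ with h | h <;> simp [h]
  have hd1 : (δ : ℝ) ≤ 1 := by rcases hδ with h | h <;> simp [h]
  -- the form is symmetric: `P = i'² + i'j' + j'²` with `i' = i + δ/3`, `j' = j + δ/3`
  have hsym : ((i : ℝ) + j / 2 + δ / 2) ^ 2 + 3 / 4 * ((j : ℝ) + δ / 3) ^ 2 =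
      ((j : ℝ) + i / 2 + δ / 2) ^ 2 + 3 / 4 * ((i : ℝ) + δ / 3) ^ 2 := by ring
  -- one-variable bound: `(|m| - 1/3)² ≤ (m + δ/3)²` for an integer `m ≠ 0`
  have hone : ∀ m : ℤ, 1 ≤ |m| → ((|m| : ℤ) : ℝ) - 1 / 3 ≥ 0 ∧
      (((|m| : ℤ) : ℝ) - 1 / 3) ^ 2 ≤ ((m : ℝ) + δ / 3) ^ 2 := by
    intro m hm
    have hm' : (1 : ℝ) ≤ ((|m| : ℤ) : ℝ) := by exact_mod_cast hm
    refine ⟨by linarith, ?_⟩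
    rcases le_or_gt 0 m with h0 | h0
    · have : ((|m| : ℤ) : ℝ) = m := by rw [abs_of_nonneg h0]
      rw [this] at hm' ⊢
      nlinarith
    · have : ((|m| : ℤ) : ℝ) = -m := by rw [abs_of_neg h0]; push_cast; ring
      rw [this] at hm' ⊢
      nlinarith [mul_nonneg (show (0 : ℝ) ≤ 1 / 3 - δ / 3 by linarith)
        (show (0 : ℝ) ≤ -(2 * m + δ / 3 + 1 / 3) by linarith)]
  rcases le_total |i| |j| with hij | hij
  · rw [max_eq_right hij] at hr ⊢
    obtain ⟨_, h2⟩ := hone j hr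
    nlinarith [sq_nonneg ((i : ℝ) + j / 2 + δ / 2)]
  · rw [max_eq_left hij] at hr ⊢
    obtain ⟨_, h2⟩ := hone i hr
    rw [hsym]
    nlinarith [sq_nonneg ((j : ℝ) + i / 2 + δ / 2)]

/-! ## Summability of the Lennard-Jones layer terms -/

/-- **The Lennard-Jones layer terms are summable over the layer**: for `a ∈ [47/50, 1]`,
`δ ∈ {0, 1}` and a height `x > 0`, the family
`(i,j) ↦ (1/12)(a²P_δ(i,j) + x²)⁻⁶ - (1/6)(a²P_δ(i,j) + x²)⁻³` is summable. [folklore] -/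
theorem cvx_summable_layerTerm (a : ℝ) (ha : 47 / 50 ≤ a) (δ : ℤ) (hδ : δ = 0 ∨ δ = 1)
    (x : ℝ) (hx : 0 < x) :
    Summable fun ij : ℤ × ℤ =>
      1 / 12 * ((a ^ 2 * (((ij.1 : ℝ) + ij.2 / 2 + δ / 2) ^ 2 +
        3 / 4 * ((ij.2 : ℝ) + δ / 3) ^ 2) + x ^ 2)⁻¹) ^ 6 -
      1 / 6 * ((a ^ 2 * (((ij.1 : ℝ) + ij.2 / 2 + δ / 2) ^ 2 +
        3 / 4 * ((ij.2 : ℝ) + δ / 3) ^ 2) + x ^ 2)⁻¹) ^ 3 := by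
  have ha0 : 0 < a := by linarith
  set t := x ^ 2 / a ^ 2 with ht
  have ht0 : 0 < t := by positivity
  -- the constant of the cubic majorant
  set C := (1 / 12 * ((x ^ 2)⁻¹) ^ 3 + 1 / 6) * (a⁻¹) ^ 6 with hC
  have hC0 : 0 ≤ C := by positivity
  apply Summable.of_abs
  refine (cvx_lattice_tsum_le (F := fun ij : ℤ × ℤ => |1 / 12 * ((a ^ 2 * (((ij.1 : ℝ) + ij.2 / 2 +
      δ / 2) ^ 2 + 3 / 4 * ((ij.2 : ℝ) + δ / 3) ^ 2) + x ^ 2)⁻¹) ^ 6 -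
      1 / 6 * ((a ^ 2 * (((ij.1 : ℝ) + ij.2 / 2 + δ / 2) ^ 2 +
        3 / 4 * ((ij.2 : ℝ) + δ / 3) ^ 2) + x ^ 2)⁻¹) ^ 3|) (fun p => abs_nonneg _)
      (N := 1) (n := 2) le_rfl (by norm_num) hC0 ht0 ?_).1
  intro p hp
  set P := ((p.1 : ℝ) + p.2 / 2 + δ / 2) ^ 2 + 3 / 4 * ((p.2 : ℝ) + δ / 3) ^ 2 with hP
  have hP0 : 0 ≤ P := by rw [hP]; positivity
  have hshell := cvx_P_ge_shell δ hδ p (by omega)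
  rw [← hP] at hshell
  -- `w = (a²P + x²)⁻¹ = a⁻² (P + t)⁻¹ ≤ x⁻²`
  set w := (a ^ 2 * P + x ^ 2)⁻¹ with hw
  have hq0 : 0 < a ^ 2 * P + x ^ 2 := by positivity
  have hw0 : 0 ≤ w := by rw [hw]; positivity
  have hwx : w ≤ (x ^ 2)⁻¹ := by
    rw [hw]; apply inv_anti₀ (by positivity); nlinarith [mul_nonneg (sq_nonneg a) hP0]
  have hwt : w = (a⁻¹) ^ 2 * (P + t)⁻¹ := by
    rw [hw, ht]; field_simp
  have hPt : (P + t)⁻¹ ≤ (3 / 4 * (((max |p.1| |p.2| : ℤ) : ℝ) - 1 / 3) ^ 2 + t)⁻¹ := by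
    apply inv_anti₀ (by positivity); linarith
  have hmaj : |1 / 12 * w ^ 6 - 1 / 6 * w ^ 3| ≤ C * ((3 / 4 * (((max |p.1| |p.2| : ℤ) : ℝ) - 1 / 3) ^ 2 + t)⁻¹) ^ 3 := by
    have h1 : |1 / 12 * w ^ 6 - 1 / 6 * w ^ 3| ≤ 1 / 12 * w ^ 6 + 1 / 6 * w ^ 3 := by
      rw [abs_le]; constructor <;> nlinarith [pow_nonneg hw0 6, pow_nonneg hw0 3]
    have h2 : w ^ 6 ≤ ((x ^ 2)⁻¹) ^ 3 * w ^ 3 := by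
      have : w ^ 3 ≤ ((x ^ 2)⁻¹) ^ 3 := pow_le_pow_left₀ hw0 hwx 3
      nlinarith [pow_nonneg hw0 3]
    have h3 : w ^ 3 = (a⁻¹) ^ 6 * ((P + t)⁻¹) ^ 3 := by rw [hwt]; ring
    have h4 : ((P + t)⁻¹) ^ 3 ≤ ((3 / 4 * (((max |p.1| |p.2| : ℤ) : ℝ) - 1 / 3) ^ 2 + t)⁻¹) ^ 3 :=
      pow_le_pow_left₀ (by positivity) hPt 3
    calc |1 / 12 * w ^ 6 - 1 / 6 * w ^ 3| ≤ 1 / 12 * w ^ 6 + 1 / 6 * w ^ 3 := h1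
      _ ≤ 1 / 12 * (((x ^ 2)⁻¹) ^ 3 * w ^ 3) + 1 / 6 * w ^ 3 := by linarith
      _ = (1 / 12 * ((x ^ 2)⁻¹) ^ 3 + 1 / 6) * (a⁻¹) ^ 6 * ((P + t)⁻¹) ^ 3 := by rw [h3]; ring
      _ ≤ (1 / 12 * ((x ^ 2)⁻¹) ^ 3 + 1 / 6) * (a⁻¹) ^ 6 *
          ((3 / 4 * (((max |p.1| |p.2| : ℤ) : ℝ) - 1 / 3) ^ 2 + t)⁻¹) ^ 3 :=
          mul_le_mul_of_nonneg_left h4 (by positivity)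
      _ = _ := by rw [hC]
  simpa only [hw, hP] using hmaj

end Summit.AtomisticToContinuum.Crystallization.Theorems.LayeredHull

end
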